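import Literature.NumberTheory.EllipticCurves.OrdinaryLocalCondition
import Literature.NumberTheory.EllipticCurves.HeegnerPointsKolyvaginPairing
import Literature.NumberTheory.EllipticCurves.ZhangLevelRaisedHeegnerData
import Literature.NumberTheory.GaloisRepresentations.IntegralGaloisAction
import HarnessLib

/-!
# The TORIC (Bertolini–Darmon «ordinary ∕ singular») and the TRANSVERSE (Kolyvagin ∕ W. Zhang) local conditions
# in `H¹(K, E[n])`, as subgroups — Literature vocabulary for W. Zhang's level-raised Kolyvagin systems

Topic `Literature/NumberTheory/EllipticCurves`. DEFINITIONS WITH BODIES plus their definitional unfolding lemmas;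
no named fact, no `sorry`, no instance, no notation. Nothing is asserted about admissible primes, Kolyvagin primes
or Selmer groups.

WHY THIS FILE. W. Zhang's level-raised Kolyvagin classes `c(n, m) ∈ H¹(K, V)`, `V = E[p]` (Camb. J. Math. 2 (2014),
§3.9 (3.30)) are pinned as data in `ZhangLevelRaisedKolyvaginData` (this directory); the printed facts ABOUT them —
§8.1 property (1) and (8.1), Thm. 4.3 (4.3)/(4.5), Thm. 5.2 — speak of three local conditions at a finite place
`v` of `K`: the FINITE ∕ Kummer condition (`selmerLocalKer`, in the tree), the ORDINARY = TORIC condition at a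
level-raising (admissible) prime `q` (Bertolini–Darmon 2005 §2.2–§2.3: `H¹_ord(K_q, T) = im H¹(K_q, T⁺)`,
`T⁺ = μ`-line of the Tate-curve filtration of every form raised at `q`; Zhang §4.1 (4.1)–(4.2): at an admissible
`q` the singular part `H¹_sing(K_q, V) ≃ H¹(K_q, k₀(1))`), and the TRANSVERSE condition at a Kolyvagin prime `ℓ`
(Zhang §8.1: `H¹(K_ℓ, V) = H¹_fin ⊕ H¹_tr`, `H¹_tr` inflated from the totally ramified layer `K[ℓ]_λ/K_λ`;
Gross 1991 §3–§4).  The last two were so far typed only Summits-side (route `AdditiveKolyvaginRoad`, file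
`Theorems/AdditiveKolyvaginRoadLevelDefs.lean` §0: `augmentationPoints`, `toricLocalKer`; file
`Theorems/AdditiveKolyvaginRoadLevelSystems.lean`: `transverseLocalKerP`), which a Literature statement cannot
import.  This file is their Literature home, with IDENTICAL bodies (so the Summit-side bridge is `rfl`), built only
from Literature objects already in the tree: `WeierstrassCurve.valuedLocalKer` (`OrdinaryLocalCondition`),
`localPoints` (`Sha`), `h1Eval` ∕ `torsionFixing` (`HeegnerPointsKolyvaginPairing`), `ringClassStabilizer`
(`ZhangLevelRaisedHeegnerData`), `HeightOneSpectrum.primesAbove` ∕ `Ideal.decompositionSubgroup`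
(`IntegralGaloisAction`).

## The printed notions (verbatim) and the transcription

* Bertolini–Darmon 2005, §2.2 (p. 18): for an admissible prime `ℓ` the Tate-curve filtration
  `0 → T⁺ → T → T⁻ → 0` over `K_ℓ` and *"the ordinary part `H¹_ord(K_ℓ, T) := im(H¹(K_ℓ, T⁺) → H¹(K_ℓ, T))`"*;
  §2.3: the Selmer group `Sel_{f,n}` attached to a level-raised form imposes the ordinary condition at the primes
  of the level and the finite condition elsewhere.  W. Zhang 2014, §4.1 (p. 217): *"as `Gal_{K_q}`-modules, the
  vector space `V` splits as a direct sum of two `k₀`-lines `V ≃ k₀ ⊕ k₀(1)` … `q ≡ ±1 mod p`. Hence the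
  `Gal_{K_q}`-action is nontrivial on `k₀(1)`. In particular, the direct sum decomposition is unique"*, Lemma 4.2:
  *"`H¹_fin(K_q, V) = H¹(K_q, k₀)`, and, the restriction map induces an isomorphism
  `H¹_sing(K_q, V) ≃ H¹(K_q, k₀(1))`"*.  TRANSCRIPTION (`p`-uniform, no eigen-decomposition needed): the line
  `k₀(1)` on which `Gal_{K_q}` acts non-trivially is the AUGMENTATION line `I_{Γ_{K_q}} · V = ⟨g v − v⟩`
  (`augmentationSubgroup`; for `V = k₀ ⊕ k₀(1)` with `k₀(1)` a non-trivial character this is exactly `k₀(1)`),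
  and `toricLocalCondition W E n` is the subgroup of `H¹(K, E[n])` of classes whose localisation at the `K`-field
  `E = K_q` is represented by an augmentation-line-valued cocycle (`valuedLocalKer`) — i.e. lies in
  `im H¹(K_q, k₀(1)) = H¹_sing = H¹_ord` for the level-raised forms.
* W. Zhang 2014, §8.1 (p. 235): *"For a Kolyvagin prime `ℓ` we have `H¹(K_ℓ, V) = H¹_fin(K_ℓ, V) ⊕ H¹_tr(K_ℓ, V)`
  where `H¹_tr` is the transverse part, i.e. the subspace inflated from `H¹(K[ℓ]_λ/K_λ, V)`"* (Gross 1991 §3: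
  `λ` the prime of `K` over `ℓ`, totally ramified in `K[ℓ]`; §4 (4.4)).  TRANSCRIPTION (Gross's pairing currency,
  tree `h1Eval`): `x` is TRANSVERSE at the place `v ∋ ℓ` iff its cocycle value `[x, d]` vanishes at every `d`
  in the decomposition group of a prime `𝔓 ∣ v` of `\bar ℤ_K` which lies in `Gal(K̄/K[ℓ])`
  (`ringClassStabilizer K ι ℓ ℓ`) and in `Gal(K̄/K(E[n]))` (`torsionFixing`, where `[x, d]` is cocycle-independent)
  — the restriction of `x` to `Gal(K̄_v/K[ℓ]_λ)` is zero, i.e. `x_v` is inflated from `K[ℓ]_λ/K_v`.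

## Main definitions

* `Literature.NumberTheory.EllipticCurves.augmentationSubgroup G M` — `I_G · M = ⟨g • x − x⟩ ≤ M`.
* `WeierstrassCurve.toricLocalCondition W E n ≤ H¹(K, E[n])` — the toric ∕ BD-ordinary condition at the
  `K`-field `E` (body = Summit-side `AdditiveKoly.toricLocalKer`).
* `Literature.NumberTheory.EllipticCurves.transverseLocalCondition W K ι n ℓ v ≤ H¹(K, E[n])` (for `E/ℚ` base
  changed to `K`, `ι : K →+* ℂ` fixing the ring class fields) — the transverse condition at `v ∋ ℓ` (body =
  Summit-side `AdditiveKoly.transverseLocalKerP` with the level `p ^ 1` generalised to `n`).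

## References
* [BertoliniDarmon2005] M. Bertolini, H. Darmon, *Iwasawa's Main Conjecture for elliptic curves over
  anticyclotomic ℤ_p-extensions*, Ann. of Math. 162 (2005), §2.2–§2.3 (p. 18).
* [WZhang2014] W. Zhang, *Selmer groups and the indivisibility of Heegner points*, Camb. J. Math. 2 (2014),
  §4.1 (4.1)–(4.2), Lemma 4.2 (p. 217); §8.1 (p. 235).
* [GrossLMS1991] B. H. Gross, *Kolyvagin's work on modular elliptic curves*, LMS LN 153 (1991), §3–§4 (4.4).
* [McCallumLMS1991] W. G. McCallum, *Kolyvagin's work on Shafarevich–Tate groups*, LMS LN 153 (1991), §4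
  (`H¹_f ⊕ H¹_s`).
-/

noncomputable section

open scoped Classical

universe u

namespace Literature.NumberTheory.EllipticCurves

open WeierstrassCurve NumberField IsDedekindDomain Literature.NumberTheory.GaloisRepresentations

/-! ## §1 The augmentation line and the toric local condition -/

section Toric

/-- **The augmentation subgroup `I_G · M = ⟨g • x − x : g ∈ G, x ∈ M⟩`** of a `G`-module `M` (the kernel of
`M → M_G` onto the co-invariants).  For `M = V|_{Gal_{K_q}} ≅ k₀ ⊕ k₀(1)` at a Bertolini–Darmon admissible prime
`q` (`Gal_{K_q}` acting non-trivially on `k₀(1)`, Zhang §4.1) it is the line `k₀(1)`.  (Body identical to the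
Summit-side `AdditiveKoly.augmentationPoints`.) [cite: WZhang2014, §4.1 (4.1) (V ≃ k₀ ⊕ k₀(1), p. 217)] -/
def augmentationSubgroup (G : Type*) (M : Type*) [Monoid G] [AddCommGroup M] [DistribMulAction G M] :
    AddSubgroup M :=
  AddSubgroup.closure {m : M | ∃ (g : G) (x : M), m = g • x - x}

variable {K : Type u} [Field K] (W : WeierstrassCurve K) (E : Type u) [Field E] [Algebra K E]

/-- **The TORIC (Bertolini–Darmon ordinary ∕ Zhang singular) local condition at the `K`-field `E`** (a completion
`K_q`): the classes `x ∈ H¹(K, E[n])` whose localisation `x_v ∈ H¹(E, E(K̄_E)[n])` is represented by a cocycle with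
values in the augmentation line `I_{Γ_E} · E(K̄_E)[n]` (tree `WeierstrassCurve.valuedLocalKer`).  At an admissible
prime `q` of a form congruent to `E` mod `p` this is `im (H¹(K_q, k₀(1)) → H¹(K_q, V)) = H¹_sing(K_q, V)`
(Zhang Lemma 4.2 (2)) = Bertolini–Darmon's `H¹_ord(K_q, T/p) = im H¹(K_q, T⁺)` for every form raised at `q` — the
local condition of the LEVEL-RAISED Selmer group at the primes of the level.  (Body identical to the Summit-side
`AdditiveKoly.toricLocalKer`; `p`-uniform replacement of `WeierstrassCurve.ordinaryLocalKer`, which at `p ≥ 5` is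
the finite condition — see the WARNING in `OrdinaryLocalCondition`.)
[cite: BertoliniDarmon2005, §2.2–§2.3 (H¹_ord = im H¹(K_ℓ, T⁺), p. 18)]
[cite: WZhang2014, §4.1 Lemma 4.2 (2) (H¹_sing(K_q, V) ≃ H¹(K_q, k₀(1)), p. 217)] -/
def _root_.WeierstrassCurve.toricLocalCondition (n : ℤ) : AddSubgroup (galH1Torsion W n) :=
  W.valuedLocalKer E n
    (augmentationSubgroup (Field.absoluteGaloisGroup E) (AddSubgroup.torsionBy (localPoints W E) n))

/-- Unfolding `toricLocalCondition` (definitional). [cite: BertoliniDarmon2005, §2.2 (H¹_ord)] -/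
theorem _root_.WeierstrassCurve.toricLocalCondition_eq (n : ℤ) :
    W.toricLocalCondition E n = W.valuedLocalKer E n
      (augmentationSubgroup (Field.absoluteGaloisGroup E) (AddSubgroup.torsionBy (localPoints W E) n)) :=
  rfl

end Toric

/-! ## §2 The transverse local condition at a Kolyvagin prime -/

section Transverse

variable (W : WeierstrassCurve ℚ) (K : Type) [Field K] [NumberField K] (ι : K →+* ℂ) (n : ℤ)

/-- **The TRANSVERSE local condition at `ℓ`** (W. Zhang 2014, §8.1: `H¹(K_ℓ, V) = H¹_fin ⊕ H¹_tr`, *"`H¹_tr` is the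
transverse part, i.e. the subspace inflated from `H¹(K[ℓ]_λ/K_λ, V)`"*; Gross 1991 §3: `λ ∣ ℓ` is totally ramified
in the ring class field `K[ℓ]`): for `E/ℚ` with model `W` base changed to the number field `K`, an embedding
`ι : K →+* ℂ` (fixing the ring class fields `K[ℓ] = ringClassField K ι ℓ ⊂ ℂ`), a level `n`, a prime number `ℓ`
and a finite place `v` of `K`: the subgroup of `H¹(K, E[n])` of classes `x` whose cocycle value `[x, d]` (tree
`h1Eval`, Gross's pairing of §9) vanishes at every `d ∈ Gal(K̄/K)` lying in the decomposition group of a prime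
`𝔓 ∣ v` of `\bar ℤ_K`, in `Gal(K̄/K[ℓ])` (`ringClassStabilizer K ι ℓ ℓ`) and in `Gal(K̄/K(E[n]))` (`torsionFixing`,
on which `[x, d]` is cocycle-independent) — i.e. `res x = 0` on `Gal(K̄_v/K[ℓ]_λ)`: `x_v` is inflated from the
totally ramified layer `K[ℓ]_λ/K_v`.  Meant for `v` the place of a Kolyvagin prime `ℓ` (inert in `K`); junk
elsewhere.  (Body identical to the Summit-side `AdditiveKoly.transverseLocalKerP`, level `p ^ 1` generalised to `n`.)
[cite: WZhang2014, §8.1 (H¹_tr, p. 235)] [cite: GrossLMS1991, §3–§4 (K_λ totally ramified in K_n; (4.4))] -/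
def transverseLocalCondition (ℓ : ℕ) (v : HeightOneSpectrum (𝓞 K)) :
    AddSubgroup (galH1Torsion (W.baseChange K) n) where
  carrier := {x | ∀ 𝔓 ∈ v.primesAbove, ∀ d : Field.absoluteGaloisGroup K,
    d ∈ 𝔓.decompositionSubgroup (Field.absoluteGaloisGroup K) → d ∈ ringClassStabilizer K ι ℓ ℓ →
    d ∈ torsionFixing (W.baseChange K) n → h1Eval (W.baseChange K) n x d = 0}
  zero_mem' := fun _ _ _ _ _ hd ↦ h1Eval_zero (W.baseChange K) _ hd
  add_mem' := fun {x y} hx hy 𝔓 h𝔓 d hdD hdS hdT ↦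
    (h1Eval_add (W.baseChange K) _ x y hdT).trans
      ((congrArg₂ (· + ·) (hx 𝔓 h𝔓 d hdD hdS hdT) (hy 𝔓 h𝔓 d hdD hdS hdT)).trans (add_zero 0))
  neg_mem' := fun {x} hx 𝔓 h𝔓 d hdD hdS hdT ↦
    (h1Eval_neg (W.baseChange K) _ x hdT).trans ((congrArg Neg.neg (hx 𝔓 h𝔓 d hdD hdS hdT)).trans neg_zero)

variable {W K ι n} in
/-- Membership in the transverse condition (definitional). [cite: WZhang2014, §8.1 (H¹_tr)] -/
theorem mem_transverseLocalCondition_iff {ℓ : ℕ} {v : HeightOneSpectrum (𝓞 K)}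
    {x : galH1Torsion (W.baseChange K) n} :
    x ∈ transverseLocalCondition W K ι n ℓ v ↔ ∀ 𝔓 ∈ v.primesAbove, ∀ d : Field.absoluteGaloisGroup K,
      d ∈ 𝔓.decompositionSubgroup (Field.absoluteGaloisGroup K) → d ∈ ringClassStabilizer K ι ℓ ℓ →
      d ∈ torsionFixing (W.baseChange K) n → h1Eval (W.baseChange K) n x d = 0 :=
  Iff.rfl

end Transverse

end Literature.NumberTheory.EllipticCurves

end
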